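import Literature.NumberTheory.LFunctions.RodgersTaoMainAsymptoticsProofs
import Literature.NumberTheory.LFunctions.RodgersTaoLogDerivAsymptoticsProofs
import Literature.NumberTheory.LFunctions.RodgersTaoTailSumRegimeThreeProofs
import Literature.NumberTheory.LFunctions.DobnerLemma4Tools
import HarnessLib

/-!
# Rodgers–Tao 2020, §2, p. 19: `H_t(x − iy) = (½ + O_C(log²₊x/x)) Q_{t,1}` — the tail sum (proofs)

RH-FREE literature proofs (no new facts, no `def`s, no instances, no notation). Trunk T-ANT
(`Literature/NumberTheory/LFunctions`); node **R19-RED** of the C3 discharge tail (rt-lead ruling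
(30)(b)/(31)(a), rt/STATUS 2026-08-26): the display of FMP p. 19,
`Literature.NumberTheory.LFunctions.rodgersTao_H_eq_half_Q_one`, REDUCED to the named facts of
`RodgersTaoAsymptotics.lean` it is printed to follow from — Lemma 2.3 (= FMP Lemma 6,
`Literature.NumberTheory.LFunctions.rodgersTao_saddlePoint`), eq. (31)
(`Literature.NumberTheory.LFunctions.rodgersTao_I_asymp`), eq. (22)
(`Literature.NumberTheory.LFunctions.rodgersTao_I_shift`, carried in the signature of record, not
used), the series (18) = (32) (`Literature.NumberTheory.LFunctions.rodgersTao_H_hasSum_Q`) and the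
`n = 1` refinement (36) (`Literature.NumberTheory.LFunctions.rodgersTao_Q_one_asymp`). The
reduction itself uses only the statement module `RodgersTaoAsymptotics`; the § LEAF at the end feeds
it the kernel theorems `…_holds` of `RodgersTaoAsymptoticsProofs.lean` and closes, hypothesis-free,
the p. 19 display, Lemma 2.1 (ii) = (8) (via `rodgersTao_H_asymp_of`,
`RodgersTaoMainAsymptoticsProofs.lean`) and Lemma 2.1 (iii) = (9) (via
`rodgersTao_logDeriv_H_asymp_of_H_eq_half_Q_one`, `RodgersTaoLogDerivAsymptoticsProofs.lean`).

> B. Rodgers, T. Tao, *The de Bruijn–Newman constant is non-negative*, Forum Math. Pi 8 (2020)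
> e6 = arXiv:1801.05914v5 (held TeX rt/src/RodgersTao_arXiv1801.05914v5.tex l.430–497 = FMP
> pp. 17–19). (32): "`H_t(x−iy) = ½ ∑_{n=1}^∞ Q_{t,n}`". (33): "We first consider the estimation of
> `Q_n` in the main case when `n` is not too huge, in the sense that `n ≤ x exp(100 x^{1/2}/|t|)`."
> … "In particular we have the upper bound `Q_{t,n} ≪ n⁴ (x/4πn²)^{(9+y)/4} J_t K_{t,n}` … Using the
> crude bound `K_{t,n} ≤ exp(−(t/4)(log(x/4π)) log n) ≤ n^{−(t/4) log x}` we conclude that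
> `Q_{t,n} ≪ n^{−(1+y)/2 − (t/4) log x} |Q_{t,1}|`. Since `y ≥ C' log₊ x`, the
> `2 ≤ n ≤ x exp(100 x^{1/2}/|t|)` terms sum to `O(|Q_{t,1}|/x)`" … "Suppose now that
> `n > x exp(100 x^{1/2}/|t|)`. If we now apply Lemma 2.3(iii) … `α` is negative with
> `−α ≥ ⅛ log n`, while from (31) and (24) (and Lemma 2.3(i)) we have
> `I_t(πn², 9+y+ix) ≪ exp(Re(tw₀² − ζ/4 − tw₀/2 + ζw₀)) ≪ exp(−|t||α|² − |t||α|/2 + O_C(log²₊x))`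
> … Summing, we conclude that `∑_{n > x exp(100 x^{1/2}/|t|)} Q_{t,n} ≪ exp(−100x/|t|)` (say),
> which is certainly `O(|Q₁|/x)`. Inserting these bounds into (18), we conclude that
> `H_t(x−iy) = (½ + O_C(log²₊x/x)) Q_{t,1}`."

## Main result

* `Literature.NumberTheory.LFunctions.rodgersTao_H_eq_half_Q_one_of` — the p. 19 display from the
  five named facts (signature of record, ruling (30)(b)): `rodgersTao_saddlePoint →
  rodgersTao_I_asymp → rodgersTao_I_shift → rodgersTao_H_hasSum_Q → rodgersTao_Q_one_asymp →
  rodgersTao_H_eq_half_Q_one`.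
* § LEAF: `rodgersTao_H_eq_half_Q_one_holds`, `rodgersTao_H_asymp_holds` (Lemma 2.1 (ii), eq. (8)),
  `rodgersTao_logDeriv_H_asymp_holds` (Lemma 2.1 (iii), eq. (9)) — hypothesis-free.
  A second, pipelined proof of the same display over `RodgersTaoTailSumWrapperProofs` /
  `…RegimeTwoProofs` / `…RegimeThreeProofs` / `…AssemblyProofs` (rt seats t1/t5/rt-iso/t7) was
  being assembled concurrently; this module is independent of those except that it reuses the
  polar form of (23), `rodgersTao_saddleEq_re_im`, from `RodgersTaoTailSumRegimeThreeProofs`.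

## Proof route and divergence from print

For every `n ≥ 2` the term `Q_{t,n}` is bounded in modulus by `M · T₉(x) · n^{−2} x^{−2}`,
`T₉(x) = (x/4π)^{(9+y)/4} J_t(x)`, whence `∑_{n≥2} |Q_{t,n}| ≤ 2M T₉/x² ≤ (2M/π²) |Q_{t,1}|/x²` by
(36). (R1) From (31) and Lemma 2.3 (i): `|I_t(b, ζ)| ≤ (2 + A/(¼)^{3/2}) exp E`,
`E = Re(tw₀² − ζ/4 − tw₀/2 + ζw₀) = t(α² − β²) − (a+y)/4 − tα/2 + (a+y)α − xβ` (`ζ = a+y+ix`,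
`w₀ = α + iβ`, using (23) `4be^{4w₀} = ζ + 2tw₀`). (R2) In the regime `πn² ≤ x e^{100√x/|t|}`,
Lemma 2.3 (ii) gives `E ≤ (a+y)ℓ_n/4 + tℓ_n²/16 − tπ²/64 − πx/8 + 3A₁ + A₂` (`ℓ_n = log(x/4πn²)`;
upper bounds with `O(1)` slack suffice for `n ≥ 2`, the source's `e^{O_C(x^{−1/2})}` precision is
needed only at `n = 1`, which is the fact (36)); the crude bound on `K_{t,n}` then gives
`|Q_{t,n}| ≤ K₁ √x T₉ n^{2 − (5+y)/2 + (T₀/4) log(x/4π)}`, summable to `O(T₉/x²)` once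
`C' ≥ T₀/2 + 16`. (R3) In the regime `πn² > x e^{100√x/|t|}` (where Lemma 2.3 (iii) applies):
**DIVERGENCE.** The printed chain "`n⁴ e^{−|t||α|²} ≪ e^{−9√x log n}` … `≪ e^{−100x/|t|} = O(|Q₁|/x)`"
compares with `|Q₁| ≍ e^{−πx/8 + O_C(log²₊x)}` and thus tacitly uses `|t| = O(1)` (`|t| ≤ |Λ|` in
the source); for the typed range `−T₀ ≤ t < 0` with `T₀` arbitrary we extract the factor `e^{−πx/8}`
from the IMAGINARY PART of the saddle equation (23): `4be^{4α} sin 4β = x + 2tβ`,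
`4be^{4α} cos 4β = a + y + 2|t||α|`, so `x(π/8 − β) ≤ (x/4) cot 4β ≤ (a+y)/2 + |t||α|` (`tan u ≥ u`),
giving `E ≤ −πx/8 − |t|α²/2 + (a+y)/4 + T₀π²/64 + T₀/8` (AM–GM `|α| ≤ α² + ¼` in place of the
printed `|α| ≥ 1`), while the regime inequality itself gives `|t| log n ≥ 50√x`, so that with
Lemma 2.3 (iii) `−α ≥ log₊(πn²)/8 ≥ (log n)/4`: `|t|α²/2 ≥ (25/16)√x log n`; uniform in `T₀`.
(R4) Assembly with the `HasSum` (32) and (36).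

bears_on: N-C/N-P (COLUMN 3 DBN). WHAT THIS IS NOT: a tail-sum estimate inside the RH-free
asymptotic analysis of `H_t`, `t < 0`; nothing here bears on the truth of RH.
-/

noncomputable section

open Complex Filter Set Topology Real

namespace Literature.NumberTheory.LFunctions

namespace RodgersTaoTailSum

/-! ### (R1) From (31) to `|I_t| ≤ A' e^{Re Φ}` -/

/-- `‖B^{-1/2}‖ ≤ 2` when `Re(4B) ≥ 1` (then `‖B‖ ≥ ¼`). [cite: RodgersTaoFMP2020, Lemma 2.3 (i) (FMP p. 12)] -/
theorem norm_cpow_neg_half_le {B : ℂ} (hB : 1 ≤ (4 * B).re) : ‖B ^ (-(1 / 2 : ℂ))‖ ≤ 2 := by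
  have hBn : 1 / 4 ≤ ‖B‖ := by
    have h1 : (4 * B).re ≤ ‖4 * B‖ := Complex.re_le_norm _
    rw [norm_mul, Complex.norm_ofNat] at h1
    linarith
  have hB0 : B ≠ 0 := fun h ↦ by rw [h, norm_zero] at hBn; norm_num at hBn
  set s : ℂ := B ^ (-(1 / 2 : ℂ)) with hs
  have hss : s * s = B⁻¹ := by
    rw [hs, ← Complex.cpow_add _ _ hB0, show -(1 / 2 : ℂ) + -(1 / 2 : ℂ) = -1 by ring,
      Complex.cpow_neg_one]
  have h2 : ‖s‖ * ‖s‖ ≤ 2 * 2 := by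
    rw [← norm_mul, hss, norm_inv]
    calc ‖B‖⁻¹ ≤ (1 / 4)⁻¹ := inv_anti₀ (by norm_num) hBn
      _ = 2 * 2 := by norm_num
  nlinarith [norm_nonneg s]

/-- **(R1)** From the asymptotic (31) `‖I − √(π/8) e^Φ B^{−1/2}‖ ≤ A‖e^Φ‖/‖B‖^{3/2}` with
`B = be^{4w₀}`, `Re(4B) ≥ 1` (Lemma 2.3 (i)): `‖I‖ ≤ (2 + A/(¼)^{3/2}) ‖e^Φ‖`.
[cite: RodgersTaoFMP2020, §2 eq. (31) and Lemma 2.3 (i) (FMP pp. 12, 16)] -/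
theorem norm_le_of_asymp {I e B : ℂ} {A : ℝ} (hA : 0 ≤ A) (hB : 1 ≤ (4 * B).re)
    (h : ‖I - (Real.sqrt (π / 8) : ℂ) * e * B ^ (-(1 / 2 : ℂ))‖ ≤ A * ‖e‖ / ‖B‖ ^ (3 / 2 : ℝ)) :
    ‖I‖ ≤ (2 + A / (1 / 4 : ℝ) ^ (3 / 2 : ℝ)) * ‖e‖ := by
  have hBn : 1 / 4 ≤ ‖B‖ := by
    have h1 : (4 * B).re ≤ ‖4 * B‖ := Complex.re_le_norm _
    rw [norm_mul, Complex.norm_ofNat] at h1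
    linarith
  have hc0 : 0 < (1 / 4 : ℝ) ^ (3 / 2 : ℝ) := Real.rpow_pos_of_pos (by norm_num) _
  have hB32 : (1 / 4 : ℝ) ^ (3 / 2 : ℝ) ≤ ‖B‖ ^ (3 / 2 : ℝ) :=
    Real.rpow_le_rpow (by norm_num) hBn (by norm_num)
  have hsqrt : (Real.sqrt (π / 8)) ≤ 1 := by
    rw [Real.sqrt_le_one]
    have := Real.pi_le_four
    linarith
  have hmain : ‖(Real.sqrt (π / 8) : ℂ) * e * B ^ (-(1 / 2 : ℂ))‖ ≤ 2 * ‖e‖ := by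
    rw [norm_mul, norm_mul, Complex.norm_real, Real.norm_eq_abs,
      abs_of_nonneg (Real.sqrt_nonneg _)]
    have h1 := norm_cpow_neg_half_le hB
    have h0 : 0 ≤ ‖e‖ := norm_nonneg _
    calc Real.sqrt (π / 8) * ‖e‖ * ‖B ^ (-(1 / 2 : ℂ))‖ ≤ 1 * ‖e‖ * 2 := by
          gcongr
      _ = 2 * ‖e‖ := by ring
  have herr : A * ‖e‖ / ‖B‖ ^ (3 / 2 : ℝ) ≤ A / (1 / 4 : ℝ) ^ (3 / 2 : ℝ) * ‖e‖ := by
    rw [div_mul_eq_mul_div, mul_div_assoc, mul_div_assoc]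
    exact mul_le_mul_of_nonneg_left (div_le_div_of_nonneg_left (norm_nonneg _) hc0 hB32) hA
  calc ‖I‖ = ‖(I - (Real.sqrt (π / 8) : ℂ) * e * B ^ (-(1 / 2 : ℂ))) +
        (Real.sqrt (π / 8) : ℂ) * e * B ^ (-(1 / 2 : ℂ))‖ := by rw [sub_add_cancel]
    _ ≤ ‖I - (Real.sqrt (π / 8) : ℂ) * e * B ^ (-(1 / 2 : ℂ))‖ +
        ‖(Real.sqrt (π / 8) : ℂ) * e * B ^ (-(1 / 2 : ℂ))‖ := norm_add_le _ _
    _ ≤ A / (1 / 4 : ℝ) ^ (3 / 2 : ℝ) * ‖e‖ + 2 * ‖e‖ := add_le_add (h.trans herr) hmain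
    _ = (2 + A / (1 / 4 : ℝ) ^ (3 / 2 : ℝ)) * ‖e‖ := by ring

/-- **The real part of the phase** under the saddle equation (23) `4be^{4w₀} = ζ + 2tw₀`:
`Re(tw₀² − be^{4w₀} + ζw₀) = t(α² − β²) − (Re ζ + 2tα)/4 + (Re ζ) α − (Im ζ) β` (`w₀ = α + iβ`).
[cite: RodgersTaoFMP2020, §2 eq. (24) and the display «Re(tw₀² − ζ/4 − tw₀/2 + ζw₀)» (FMP p. 18)] -/
theorem re_phase_eq {t b : ℝ} {ζ w₀ : ℂ} (hsad : rodgersTaoSaddleEq t b ζ w₀) :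
    ((t : ℂ) * w₀ ^ 2 - b * Complex.exp (4 * w₀) + ζ * w₀).re =
      t * (w₀.re ^ 2 - w₀.im ^ 2) - (ζ.re + 2 * t * w₀.re) / 4 + (ζ.re * w₀.re - ζ.im * w₀.im) := by
  have hb : (b : ℂ) * Complex.exp (4 * w₀) = (ζ + 2 * t * w₀) / 4 := by
    rw [rodgersTaoSaddleEq] at hsad
    rw [← hsad]; ring
  rw [hb]
  simp only [Complex.sub_re, Complex.add_re, Complex.mul_re, Complex.mul_im, Complex.div_ofNat_re,
    Complex.ofReal_re, Complex.ofReal_im, sq, Complex.re_ofNat, Complex.im_ofNat]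
  ring

/-! ### (R3) The huge-`n` regime: the imaginary part of the saddle equation -/

-- The saddle equation (23) in polar form (`4be^{4α} cos 4β = Re ζ + 2tα`,
-- `4be^{4α} sin 4β = Im ζ + 2tβ`) is `rodgersTao_saddleEq_re_im`
-- (`RodgersTaoTailSumRegimeThreeProofs.lean`, rt-iso), reused below.

/-- **(R3), the key step** (huge `n`; divergence from print, see the module docstring): if
`w₀ = α + iβ` lies in the strip `0 ≤ β < π/8`, solves (23) with `α < 0`, `t ∈ [−T₀, 0)`,
`Re ζ > 0` and `Im ζ = x ≥ T₀ π/2`, then `x (π/8 − β) ≤ (Re ζ)/2 + |t| |α|`.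
[cite: RodgersTaoFMP2020, §2 proof of Lemma 2.1, huge-n case (FMP p. 19)] -/
theorem mul_pi_div_eight_sub_im_le {t T₀ b x : ℝ} {ζ w₀ : ℂ} (hT : -T₀ ≤ t) (ht : t < 0)
    (hb : 0 < b) (hζre : 0 < ζ.re) (hζim : ζ.im = x) (hx : T₀ * π / 2 ≤ x) (hx0 : 0 < x)
    (hstrip : w₀ ∈ rodgersTaoStrip) (hα : w₀.re < 0) (hsad : rodgersTaoSaddleEq t b ζ w₀) :
    x * (π / 8 - w₀.im) ≤ ζ.re / 2 + |t| * |w₀.re| := by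
  obtain ⟨hcos, hsin⟩ := rodgersTao_saddleEq_re_im hsad
  rw [hζim] at hsin
  set α := w₀.re with hαdef
  set β := w₀.im with hβdef
  have hβ0 : 0 ≤ β := hstrip.1
  have hβ1 : β < π / 8 := hstrip.2
  have hpi := Real.pi_gt_three
  have htabs : |t| = -t := abs_of_neg ht
  have hαabs : |α| = -α := abs_of_neg hα
  have hR : 0 < 4 * b * Real.exp (4 * α) := by positivity
  -- the right-hand sides are positive
  have hnum : 0 < ζ.re + 2 * t * α := by nlinarith
  have hden : x / 2 ≤ x + 2 * t * β := by nlinarith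
  have hden0 : 0 < x + 2 * t * β := by linarith
  -- `β > 0` (else `sin 4β = 0 = x + 2tβ > 0`)
  have hβpos : 0 < β := by
    rcases hβ0.lt_or_eq with h | h
    · exact h
    · exfalso
      rw [← h, mul_zero, Real.sin_zero, mul_zero] at hsin
      linarith
  -- `u = π/2 − 4β ∈ (0, π/2)` and `u ≤ tan u = cos 4β / sin 4β`
  set u : ℝ := π / 2 - 4 * β with hu
  have hu0 : 0 ≤ u := by rw [hu]; linarith
  have hu1 : u < π / 2 := by rw [hu]; linarith
  have hsin0 : 0 < Real.sin (4 * β) := by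
    have := hsin ▸ hden0
    exact pos_of_mul_pos_right (by linarith) hR.le
  have htan : u ≤ Real.cos (4 * β) / Real.sin (4 * β) := by
    have h1 := Real.le_tan hu0 hu1
    rw [hu, Real.tan_pi_div_two_sub, Real.tan_eq_sin_div_cos, inv_div] at h1
    exact h1
  -- `cos 4β / sin 4β = (Re ζ + 2tα)/(x + 2tβ)`
  have hratio : Real.cos (4 * β) / Real.sin (4 * β) = (ζ.re + 2 * t * α) / (x + 2 * t * β) := by
    rw [div_eq_div_iff hsin0.ne' hden0.ne']
    have e1 : Real.cos (4 * β) * (x + 2 * t * β) =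
        Real.cos (4 * β) * (4 * b * Real.exp (4 * α) * Real.sin (4 * β)) := by rw [hsin]
    have e2 : (ζ.re + 2 * t * α) * Real.sin (4 * β) =
        (4 * b * Real.exp (4 * α) * Real.cos (4 * β)) * Real.sin (4 * β) := by rw [hcos]
    rw [e1, e2]; ring
  rw [hratio] at htan
  -- `x u / 4 ≤ (x/4)(Re ζ + 2|t||α|)/(x/2)`
  have h2 : u ≤ (ζ.re + 2 * t * α) / (x / 2) :=
    htan.trans (div_le_div_of_nonneg_left hnum.le (by linarith) hden)
  have e : x * (π / 8 - β) = x * u / 4 := by rw [hu]; ring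
  rw [e, htabs, hαabs]
  have h3 : x * u / 4 ≤ x * ((ζ.re + 2 * t * α) / (x / 2)) / 4 := by
    have := mul_le_mul_of_nonneg_left h2 hx0.le
    linarith
  have e2 : x * ((ζ.re + 2 * t * α) / (x / 2)) / 4 = (ζ.re + 2 * t * α) / 2 := by
    field_simp
    ring
  rw [e2] at h3
  have e3 : -t * -α = t * α := by ring
  rw [e3]
  linarith

/-- **(R3), the exponent bound in the huge-`n` regime**: with `E` the real part of the phase and
`α = Re w₀ < 0`, `E ≤ −πx/8 − |t|α²/2 + (Re ζ)/4 + T₀π²/64 + T₀/8`.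
[cite: RodgersTaoFMP2020, §2 proof of Lemma 2.1, huge-n case (FMP p. 19)] -/
theorem phase_le_huge {t T₀ b x : ℝ} {ζ w₀ : ℂ} (hT : -T₀ ≤ t) (ht : t < 0)
    (hb : 0 < b) (hζre : 0 < ζ.re) (hζim : ζ.im = x) (hx : T₀ * π / 2 ≤ x) (hx0 : 0 < x)
    (hstrip : w₀ ∈ rodgersTaoStrip) (hα : w₀.re < 0) (hsad : rodgersTaoSaddleEq t b ζ w₀) :
    t * (w₀.re ^ 2 - w₀.im ^ 2) - (ζ.re + 2 * t * w₀.re) / 4 + (ζ.re * w₀.re - ζ.im * w₀.im) ≤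
      -(π * x / 8) - (-t) * w₀.re ^ 2 / 2 + ζ.re / 4 + T₀ * π ^ 2 / 64 + T₀ / 8 := by
  have hkey := mul_pi_div_eight_sub_im_le hT ht hb hζre hζim hx hx0 hstrip hα hsad
  set α := w₀.re with hαdef
  set β := w₀.im with hβdef
  have hβ0 : 0 ≤ β := hstrip.1
  have hβ1 : β < π / 8 := hstrip.2
  have hpi := Real.pi_gt_three
  have htabs : |t| = -t := abs_of_neg ht
  have hαabs : |α| = -α := abs_of_neg hα
  rw [htabs, hαabs] at hkey
  rw [hζim]
  have hβsq : β ^ 2 ≤ π ^ 2 / 64 := by nlinarith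
  have h1 : t * (α ^ 2 - β ^ 2) ≤ t * α ^ 2 + T₀ * π ^ 2 / 64 := by nlinarith
  have h2 : ζ.re * α ≤ 0 := by nlinarith
  have h3 : -(x * β) ≤ -(π * x / 8) + ζ.re / 2 + -t * -α := by nlinarith
  -- AM–GM: `|α| ≤ α² + 1/4`
  have hαsq : -α ≤ α ^ 2 + 1 / 4 := by nlinarith [sq_nonneg (α + 1 / 2)]
  have h4 : -t * -α ≤ -t * (α ^ 2 + 1 / 4) := mul_le_mul_of_nonneg_left hαsq (by linarith)
  have h5 : -t * (1 / 4) ≤ T₀ * (1 / 4) := by linarith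
  linarith [h1, h2, h3, h4, h5]

/-! ### (R2) The main regime: Lemma 2.3 (ii) inserted into the phase -/

/-- **(R2)** In the regime of Lemma 2.3 (ii) (`α = ℓ_b/4 + O(A₁/x)`,
`β = π/8 − r/(4x) − tℓ_b/(8x) + O(A₂ log²₊x/x^{3/2})`, `0 ≤ β < π/8`, `r = Re ζ`, `ℓ_b = log(x/4b)`),
the real part of the phase is at most `rℓ_b/4 + tℓ_b²/16 − tπ²/64 − πx/8 + O(1)` (upper bound only;
the source's two-sided (34) with `e^{O_C(x^{-1/2})}` precision is needed at `n = 1` only, i.e. in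
the fact (36)).
[cite: RodgersTaoFMP2020, §2 eq. (33)–(34) and the display «Q_{t,n} ≪ n⁴ (x/4πn²)^{(9+y)/4} J_t K_{t,n}» (FMP p. 18)] -/
theorem phase_le_main {t T₀ x r ℓb α β A₁ A₂ L U R : ℝ} (hT : -T₀ ≤ t) (ht : t < 0)
    (hα : |α - ℓb / 4| ≤ A₁ / x)
    (hβ : |β - (π / 8 - r / (4 * x) - t * ℓb / (8 * x))| ≤ A₂ * L ^ 2 / x ^ (3 / 2 : ℝ))
    (hβ0 : 0 ≤ β) (hβ1 : β < π / 8) (hx : 1 ≤ x) (hr : 0 ≤ r) (hL : L ^ 2 ≤ Real.sqrt x)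
    (hA₁ : 0 ≤ A₁) (hA₂ : 0 ≤ A₂) (hU : -t * |ℓb| ≤ U * x) (hR : r ≤ R * x) :
    t * (α ^ 2 - β ^ 2) - (r + 2 * t * α) / 4 + (r * α - x * β) ≤
      r * ℓb / 4 + t * ℓb ^ 2 / 16 - t * π ^ 2 / 64 - π * x / 8 +
        (A₁ * U / 2 + A₁ * T₀ / 2 + R * A₁ + A₂) := by
  have hx0 : 0 < x := by linarith
  have hpi := Real.pi_gt_three
  have hmt : 0 < -t := by linarith
  have hαu : α ≤ ℓb / 4 + A₁ / x := by have := (abs_le.1 hα).2; linarith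
  have hβl : π / 8 - r / (4 * x) - t * ℓb / (8 * x) - A₂ * L ^ 2 / x ^ (3 / 2 : ℝ) ≤ β := by
    have := (abs_le.1 hβ).1; linarith
  -- (E1) `t α² ≤ t ℓb²/16 + A₁ U / 2`
  have hsq : ℓb ^ 2 / 16 - |ℓb| * (A₁ / x) / 2 ≤ α ^ 2 := by
    have e : α ^ 2 = ℓb ^ 2 / 16 + ℓb * (α - ℓb / 4) / 2 + (α - ℓb / 4) ^ 2 := by ring
    have h2 : -(|ℓb| * (A₁ / x)) ≤ ℓb * (α - ℓb / 4) := by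
      have h3 : |ℓb * (α - ℓb / 4)| ≤ |ℓb| * (A₁ / x) := by
        rw [abs_mul]; exact mul_le_mul_of_nonneg_left hα (abs_nonneg _)
      have := neg_abs_le (ℓb * (α - ℓb / 4))
      linarith
    nlinarith [sq_nonneg (α - ℓb / 4)]
  have hE1 : t * α ^ 2 ≤ t * ℓb ^ 2 / 16 + A₁ * U / 2 := by
    have h1 : t * α ^ 2 ≤ t * (ℓb ^ 2 / 16 - |ℓb| * (A₁ / x) / 2) :=
      mul_le_mul_of_nonpos_left hsq ht.le
    have h2 : -t * |ℓb| * (A₁ / x) ≤ U * x * (A₁ / x) :=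
      mul_le_mul_of_nonneg_right hU (div_nonneg hA₁ hx0.le)
    have e2 : U * x * (A₁ / x) = A₁ * U := by field_simp
    rw [e2] at h2
    have e1 : t * (ℓb ^ 2 / 16 - |ℓb| * (A₁ / x) / 2) =
        t * ℓb ^ 2 / 16 + -t * |ℓb| * (A₁ / x) / 2 := by ring
    linarith
  -- (E2) `-t β² ≤ -t π²/64`
  have hβsq : β ^ 2 ≤ π ^ 2 / 64 := by nlinarith
  have hE2 : -(t * β ^ 2) ≤ -(t * π ^ 2 / 64) := by nlinarith
  -- (E3) `-tα/2 ≤ -t ℓb/8 + A₁ T₀/2`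
  have hE3 : -(t * α) / 2 ≤ -t * ℓb / 8 + A₁ * T₀ / 2 := by
    have h1 : -t * α ≤ -t * (ℓb / 4 + A₁ / x) := mul_le_mul_of_nonneg_left hαu hmt.le
    have h2 : -t * (A₁ / x) ≤ T₀ * A₁ := by
      have h3 : A₁ / x ≤ A₁ := div_le_self hA₁ hx
      have h4 : -t * (A₁ / x) ≤ T₀ * (A₁ / x) :=
        mul_le_mul_of_nonneg_right (by linarith) (div_nonneg hA₁ hx0.le)
      have h5 : T₀ * (A₁ / x) ≤ T₀ * A₁ := mul_le_mul_of_nonneg_left h3 (by linarith)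
      linarith
    have e : -t * (ℓb / 4 + A₁ / x) = -t * ℓb / 4 + -t * (A₁ / x) := by ring
    linarith
  -- (E4) `rα ≤ rℓb/4 + R A₁`
  have hE4 : r * α ≤ r * ℓb / 4 + R * A₁ := by
    have h1 : r * α ≤ r * (ℓb / 4 + A₁ / x) := mul_le_mul_of_nonneg_left hαu hr
    have h2 : r * (A₁ / x) ≤ R * A₁ := by
      rw [mul_div_assoc', div_le_iff₀ hx0]
      calc r * A₁ ≤ R * x * A₁ := mul_le_mul_of_nonneg_right hR hA₁
        _ = R * A₁ * x := by ring
    have e : r * (ℓb / 4 + A₁ / x) = r * ℓb / 4 + r * (A₁ / x) := by ring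
    linarith
  -- (E5) `-xβ ≤ -πx/8 + r/4 + tℓb/8 + A₂`
  have hE5 : -(x * β) ≤ -(π * x / 8) + r / 4 + t * ℓb / 8 + A₂ := by
    have h1 : -(x * β) ≤
        -(x * (π / 8 - r / (4 * x) - t * ℓb / (8 * x) - A₂ * L ^ 2 / x ^ (3 / 2 : ℝ))) := by
      have := mul_le_mul_of_nonneg_left hβl hx0.le
      linarith
    have h2 : x * (A₂ * L ^ 2 / x ^ (3 / 2 : ℝ)) ≤ A₂ := by
      have hx32 : x ^ (3 / 2 : ℝ) = x * Real.sqrt x := by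
        rw [Real.sqrt_eq_rpow, ← Real.rpow_one_add' hx0.le (by norm_num)]
        norm_num
      rw [hx32]
      have hsx : 0 < Real.sqrt x := Real.sqrt_pos.2 hx0
      rw [mul_div_assoc', div_le_iff₀ (by positivity)]
      calc x * (A₂ * L ^ 2) = A₂ * L ^ 2 * x := by ring
        _ ≤ A₂ * Real.sqrt x * x := by
          have := mul_le_mul_of_nonneg_left hL hA₂
          nlinarith
        _ = A₂ * (x * Real.sqrt x) := by ring
    have e : x * (π / 8 - r / (4 * x) - t * ℓb / (8 * x) - A₂ * L ^ 2 / x ^ (3 / 2 : ℝ)) =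
        π * x / 8 - r / 4 - t * ℓb / 8 - x * (A₂ * L ^ 2 / x ^ (3 / 2 : ℝ)) := by
      field_simp
    linarith
  have e : t * (α ^ 2 - β ^ 2) - (r + 2 * t * α) / 4 + (r * α - x * β) =
      t * α ^ 2 + -(t * β ^ 2) - r / 4 + -(t * α) / 2 + r * α + -(x * β) := by ring
  rw [e]
  linarith [hE1, hE2, hE3, hE4, hE5]

/-- **(R2), the exponent comparison with `T₉`** (`ℓ_b = ℓ − 2m`, `ℓ = log(x/4π) ∈ [0, L]`,
`m = log n ≥ 2/3`, `y ≥ (T₁/2 + 16)L`, `T₁ ≥ T₀ ≥ −t > 0`, `d = (a − 1)/2`, `a ≤ 9`): the crude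
bound `K_{t,n} ≤ n^{(|t|/4) log x}` and «since `y ≥ C' log₊ x` … the `2 ≤ n ≤ …` terms sum to
`O(|Q_{t,1}|/x)`» in exponent form. [cite: RodgersTaoFMP2020, §2, FMP p. 18] -/
theorem exponent_le_main {d a y ℓ m t T₀ T₁ L lx : ℝ} (hd : d = (a - 1) / 2) (ha : a ≤ 9)
    (hℓ0 : 0 ≤ ℓ) (hℓL : ℓ ≤ L) (hm : 2 / 3 ≤ m) (hy : (T₁ / 2 + 16) * L ≤ y) (hT₁ : T₀ ≤ T₁)
    (hT : -T₀ ≤ t) (ht : t < 0) (hlx : lx ≤ L) (hL : 1 ≤ L) :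
    d * m + ((a + y) * (ℓ - 2 * m) / 4 + t * (ℓ - 2 * m) ^ 2 / 16) ≤
      (9 + y) * ℓ / 4 + t * ℓ ^ 2 / 16 - 2 * m - 5 / 2 * lx := by
  have hm0 : 0 ≤ m := by linarith
  have hL0 : 0 ≤ L := by linarith
  have h1 : (T₁ / 2 + 16) * L * m ≤ y * m := mul_le_mul_of_nonneg_right hy hm0
  have h2 : -T₀ * (ℓ * m) ≤ t * (ℓ * m) := mul_le_mul_of_nonneg_right hT (mul_nonneg hℓ0 hm0)
  have h3 : t * m ^ 2 ≤ 0 := by nlinarith [sq_nonneg m]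
  have h4 : T₀ * (L * m) ≤ T₁ * (L * m) := mul_le_mul_of_nonneg_right hT₁ (mul_nonneg hL0 hm0)
  have h4' : T₀ * (ℓ * m) ≤ T₀ * (L * m) := by
    have hT0 : 0 ≤ T₀ := by linarith
    exact mul_le_mul_of_nonneg_left (mul_le_mul_of_nonneg_right hℓL hm0) hT0
  have h5 : 1 * m ≤ L * m := mul_le_mul_of_nonneg_right hL hm0
  have h6 : 2 / 3 * L ≤ m * L := mul_le_mul_of_nonneg_right hm hL0
  have h7 : a * ℓ ≤ 9 * ℓ := mul_le_mul_of_nonneg_right ha hℓ0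
  rw [hd]
  nlinarith [h1, h2, h3, h4, h4', h5, h6, h7]

/-- **(R3), the exponent comparison with `T₉` in the huge-`n` regime**: the Gaussian decay
`|t|α²/2 ≥ (25/16)√x · log n` beats `n⁴`, `n²`, `x^{5/2}` and `e^{O_C(log²₊x)}` once
`√x ≥ 8` and `T₀/8 + T₀π²/64 + r/4 + T₀ log²₊x/16 + (5/2) log₊ x ≤ (25/48)√x`.
[cite: RodgersTaoFMP2020, §2, huge-n case (FMP p. 19)] -/
theorem exponent_le_huge {d y ℓ m t T₀ L lx r sx x q : ℝ} (hd : d ≤ 4) (hℓ0 : 0 ≤ ℓ)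
    (hℓL : ℓ ≤ L) (hy : 0 ≤ y) (hT : -T₀ ≤ t) (ht : t < 0) (hm : 2 / 3 ≤ m) (hlx : lx ≤ L)
    (hkey : 25 / 16 * sx * m ≤ q) (hsx : 8 ≤ sx)
    (hΘ : T₀ / 8 + T₀ * π ^ 2 / 64 + r / 4 + T₀ * L ^ 2 / 16 + 5 / 2 * L ≤ 25 / 48 * sx) :
    d * m + (-(π * x / 8) - q + r / 4 + T₀ * π ^ 2 / 64 + T₀ / 8) ≤
      (9 + y) * ℓ / 4 + t * ℓ ^ 2 / 16 - t * π ^ 2 / 64 - π * x / 8 - 2 * m - 5 / 2 * lx := by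
  have hm0 : 0 ≤ m := by linarith
  have hT0 : 0 ≤ T₀ := by linarith
  have hpi := Real.pi_gt_three
  have h1 : 0 ≤ (9 + y) * ℓ := mul_nonneg (by linarith) hℓ0
  have h2 : -T₀ * ℓ ^ 2 ≤ t * ℓ ^ 2 := mul_le_mul_of_nonneg_right hT (sq_nonneg ℓ)
  have h3 : T₀ * ℓ ^ 2 ≤ T₀ * L ^ 2 := mul_le_mul_of_nonneg_left (pow_le_pow_left₀ hℓ0 hℓL 2) hT0
  have h4 : 0 ≤ -t * π ^ 2 := mul_nonneg (by linarith) (sq_nonneg π)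
  have h5 : 25 / 32 * 8 * m ≤ 25 / 32 * sx * m := by nlinarith
  have h6 : 25 / 32 * sx * (2 / 3) ≤ 25 / 32 * sx * m :=
    mul_le_mul_of_nonneg_left hm (by linarith)
  have h7 : d * m ≤ 4 * m := mul_le_mul_of_nonneg_right hd hm0
  nlinarith [h1, h2, h3, h4, h5, h6, h7, hkey, hΘ]

/-! ### The bound for one oscillatory integral `I_t(πn², a + y + ix)`, `n ≥ 2` -/

/-- `log 2 ≥ 2/3`. [folklore] -/
private theorem two_thirds_le_log_two : (2 : ℝ) / 3 ≤ Real.log 2 := by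
  have := Real.log_two_gt_d9; linarith

set_option maxHeartbeats 400000 in
/-- **Per-integral bound, `n ≥ 2`, both regimes.** For `ζ = a + y + ix ∈ Ω`, `b = πn²`, `w₀` the
saddle point of Lemma 2.3 and the asymptotic (31):
`n^d |I_t(πn², ζ)| ≤ A' e^{B} e^{G₉(x)} n^{−2} x^{−5/2}`, `d = (a−1)/2`,
`G₉ = (9+y)ℓ/4 + tℓ²/16 − tπ²/64 − πx/8` (so that `(x/4π)^{(9+y)/4} J_t(x) = √(π/2x) e^{G₉}`);
`L = log₊ x`, `ℓ = log(x/4π)`, `lx = log x`, `m = log n` are passed as named reals.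
[cite: RodgersTaoFMP2020, §2 proof of Lemma 2.1, FMP pp. 18–19] -/
theorem exp_mul_norm_I_le {t T₀ T₁ x y a d A₁ A₂ AI CΩ L ℓ lx m : ℝ} {n : ℕ} {b : ℝ} {ζ : ℂ}
    (hn : 2 ≤ n) (hT : -T₀ ≤ t) (ht : t < 0) (hT₁ : T₀ ≤ T₁) (hbdef : b = π * (n : ℝ) ^ 2)
    (hζ : ζ = (a : ℂ) + y + x * I) (hLdef : L = logPlus x) (hℓdef : ℓ = Real.log (x / (4 * π)))
    (hlxdef : lx = Real.log x) (hmdef : m = Real.log n) (hx1 : 4 * π ≤ x)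
    (hxT : T₀ * π / 2 ≤ x) (hL1 : 1 ≤ L) (hLx : L ≤ 2 * x) (hL2 : L ^ 2 ≤ Real.sqrt x)
    (hsx : 8 ≤ Real.sqrt x) (hy : (T₁ / 2 + 16) * L ≤ y) (hr : a + y ≤ 2 * CΩ * L)
    (hCΩ : 0 ≤ CΩ) (ha0 : 0 ≤ a) (ha : a ≤ 9) (hd : d = (a - 1) / 2) (hA₁ : 0 ≤ A₁)
    (hA₂ : 0 ≤ A₂) (hAI : 0 ≤ AI)
    (hΘ : T₀ / 8 + T₀ * π ^ 2 / 64 + CΩ * L / 2 + T₀ * L ^ 2 / 16 + 5 / 2 * L ≤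
      25 / 48 * Real.sqrt x)
    (hSζ : (∃! w₀ : ℂ, w₀ ∈ rodgersTaoStrip ∧ rodgersTaoSaddleEq t b ζ w₀) ∧
      ∀ w₀ ∈ rodgersTaoStrip, rodgersTaoSaddleEq t b ζ w₀ →
        1 ≤ (4 * (b : ℂ) * Complex.exp (4 * w₀)).re ∧
        (b ≤ ζ.im * Real.exp (100 * Real.sqrt ζ.im / |t|) →
          |w₀.re - Real.log (ζ.im / (4 * b)) / 4| ≤ A₁ / ζ.im ∧
          |w₀.im - (π / 8 - ζ.re / (4 * ζ.im) - t * Real.log (ζ.im / (4 * b)) / (8 * ζ.im))| ≤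
            A₂ * logPlus ζ.im ^ 2 / ζ.im ^ (3 / 2 : ℝ)) ∧
        (ζ.im * Real.exp (Real.sqrt ζ.im / |t|) < b → logPlus b / 8 ≤ -w₀.re))
    (hIζ : ∀ w₀ ∈ rodgersTaoStrip, rodgersTaoSaddleEq t b ζ w₀ →
      ‖rodgersTaoI t b ζ - (Real.sqrt (π / 8) : ℂ) *
          Complex.exp (t * w₀ ^ 2 - b * Complex.exp (4 * w₀) + ζ * w₀) *
          ((b : ℂ) * Complex.exp (4 * w₀)) ^ (-(1 / 2 : ℂ))‖ ≤
        AI * ‖Complex.exp (t * w₀ ^ 2 - b * Complex.exp (4 * w₀) + ζ * w₀)‖ /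
          ‖(b : ℂ) * Complex.exp (4 * w₀)‖ ^ (3 / 2 : ℝ)) :
    Real.exp (d * m) * ‖rodgersTaoI t b ζ‖ ≤
      (2 + AI / (1 / 4 : ℝ) ^ (3 / 2 : ℝ)) *
        Real.exp (A₁ * (5 * T₁ + 100) / 2 + A₁ * T₀ / 2 + 4 * CΩ * A₁ + A₂) *
        Real.exp ((9 + y) * ℓ / 4 + (t / 16 * ℓ ^ 2 - t * π ^ 2 / 64 - π * x / 8)) *
        Real.exp (-2 * m) * Real.exp (-(5 / 2) * lx) := by
  -- ranges
  have hpi := Real.pi_gt_three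
  have hpi4 := Real.pi_le_four
  have hx0 : 0 < x := by linarith
  have hx1' : 1 ≤ x := by linarith
  have hT0 : 0 < -t := by linarith
  have hT00 : 0 ≤ T₀ := by linarith
  have hT10 : 0 ≤ T₁ := by linarith
  have htabs : |t| = -t := abs_of_neg ht
  have hn2 : (2 : ℝ) ≤ n := by exact_mod_cast hn
  have hn0 : (0 : ℝ) < n := by linarith
  have hb0 : 0 < b := by rw [hbdef]; positivity
  have hbn : (n : ℝ) ^ 2 ≤ b := by
    rw [hbdef]
    calc (n : ℝ) ^ 2 = 1 * (n : ℝ) ^ 2 := (one_mul _).symm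
      _ ≤ π * (n : ℝ) ^ 2 := mul_le_mul_of_nonneg_right (by linarith) (sq_nonneg _)
  have hm23 : 2 / 3 ≤ m := by
    rw [hmdef]; exact two_thirds_le_log_two.trans (Real.log_le_log (by norm_num) hn2)
  have hm0 : 0 ≤ m := by linarith
  have hℓ0 : 0 ≤ ℓ := by
    rw [hℓdef]; exact Real.log_nonneg (by rw [le_div_iff₀ (by positivity)]; linarith)
  have hlxL : lx ≤ L := by rw [hlxdef, hLdef]; exact log_le_logPlus x
  have hℓlx : ℓ ≤ lx := by
    rw [hℓdef, hlxdef]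
    exact Real.log_le_log (by positivity)
      (by rw [div_le_iff₀ (by positivity)]; exact le_mul_of_one_le_right hx0.le (by linarith))
  have hℓL : ℓ ≤ L := hℓlx.trans hlxL
  have hL0 : 0 < L := by linarith
  have hy0 : 0 ≤ y := le_trans (mul_nonneg (by linarith) hL0.le) hy
  have hr0 : 0 < a + y := by
    have : 16 * L ≤ (T₁ / 2 + 16) * L := mul_le_mul_of_nonneg_right (by linarith) hL0.le
    linarith
  have hζre : ζ.re = a + y := by rw [hζ]; simp
  have hζim : ζ.im = x := by rw [hζ]; simp
  have hB0 : 0 ≤ A₁ * (5 * T₁ + 100) / 2 + A₁ * T₀ / 2 + 4 * CΩ * A₁ + A₂ := by positivity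
  have hA'0 : (0 : ℝ) ≤ 2 + AI / (1 / 4 : ℝ) ^ (3 / 2 : ℝ) := by positivity
  -- logs: `log b = log π + 2m`, `log(x/4b) = ℓ − 2m`
  have hlogb : Real.log b = Real.log π + 2 * m := by
    rw [hbdef, hmdef, Real.log_mul (by positivity) (by positivity), Real.log_pow]; ring
  have hlogπ : Real.log π ≤ lx := by rw [hlxdef]; exact Real.log_le_log (by positivity) (by linarith)
  have hℓ' : ℓ = lx - Real.log 4 - Real.log π := by
    rw [hℓdef, hlxdef, Real.log_div hx0.ne' (by positivity),
      Real.log_mul (by norm_num) (by positivity)]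
    ring
  have hℓb : Real.log (x / (4 * b)) = ℓ - 2 * m := by
    rw [Real.log_div hx0.ne' (by positivity), Real.log_mul (by norm_num) hb0.ne', hlogb, hℓ',
      hlxdef]
    ring
  have hlog4 : Real.log 4 ≤ 3 := by
    have := Real.log_le_sub_one_of_pos (show (0 : ℝ) < 4 by norm_num); linarith
  have hsx0 : 0 ≤ Real.sqrt x := Real.sqrt_nonneg x
  have hsqx : Real.sqrt x ≤ x := by
    have h1 : 1 ≤ Real.sqrt x := by rw [Real.le_sqrt' one_pos]; linarith
    calc Real.sqrt x = Real.sqrt x * 1 := (mul_one _).symm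
      _ ≤ Real.sqrt x * Real.sqrt x := mul_le_mul_of_nonneg_left h1 hsx0
      _ = x := Real.mul_self_sqrt hx0.le
  -- the saddle point and the two inputs
  obtain ⟨⟨w₀, ⟨hw₀, hsad⟩, -⟩, hrest⟩ := hSζ
  obtain ⟨hi, hii, hiii⟩ := hrest w₀ hw₀ hsad
  have h31 := hIζ w₀ hw₀ hsad
  have hI : ‖rodgersTaoI t b ζ‖ ≤ (2 + AI / (1 / 4 : ℝ) ^ (3 / 2 : ℝ)) *
      Real.exp ((t : ℂ) * w₀ ^ 2 - b * Complex.exp (4 * w₀) + ζ * w₀).re := by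
    rw [← Complex.norm_exp]
    exact norm_le_of_asymp hAI (by rw [← mul_assoc]; exact hi) h31
  have hE := re_phase_eq hsad
  rw [hζre, hζim] at hE
  have hβ0 : 0 ≤ w₀.im := hw₀.1
  have hβ1 : w₀.im < π / 8 := hw₀.2
  have eG : (9 + y) * ℓ / 4 + (t / 16 * ℓ ^ 2 - t * π ^ 2 / 64 - π * x / 8) =
      (9 + y) * ℓ / 4 + t * ℓ ^ 2 / 16 - t * π ^ 2 / 64 - π * x / 8 := by ring
  -- the exponent bound `d m + Re Φ ≤ G₉ + B − 2m − (5/2) lx` in both regimes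
  have hexp : d * m + ((t : ℂ) * w₀ ^ 2 - b * Complex.exp (4 * w₀) + ζ * w₀).re ≤
      (9 + y) * ℓ / 4 + (t / 16 * ℓ ^ 2 - t * π ^ 2 / 64 - π * x / 8) +
        (A₁ * (5 * T₁ + 100) / 2 + A₁ * T₀ / 2 + 4 * CΩ * A₁ + A₂) - 2 * m - 5 / 2 * lx := by
    rw [hE]
    by_cases hcase : b ≤ x * Real.exp (100 * Real.sqrt x / |t|)
    · -- regime (ii): `πn² ≤ x e^{100√x/|t|}`
      obtain ⟨hα, hβ⟩ := hii (by rwa [hζim])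
      rw [hζim, hζre, hℓb, ← hLdef] at hβ
      rw [hζim, hℓb] at hα
      -- `-t |ℓ_b| ≤ (5T₁ + 100) x`
      have hlow : -(3 + 100 * Real.sqrt x / -t) ≤ ℓ - 2 * m := by
        have h1 : Real.log b ≤ lx + 100 * Real.sqrt x / -t := by
          have := Real.log_le_log hb0 hcase
          rwa [Real.log_mul hx0.ne' (Real.exp_pos _).ne', Real.log_exp, htabs, ← hlxdef] at this
        rw [hlogb] at h1
        rw [hℓ']
        linarith
      have hU : -t * |ℓ - 2 * m| ≤ (5 * T₁ + 100) * x := by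
        have habs : |ℓ - 2 * m| ≤ L + 3 + 100 * Real.sqrt x / -t := by
          rw [abs_le]; constructor
          · linarith
          · have : 0 ≤ 100 * Real.sqrt x / -t := by positivity
            linarith
        have h1 : -t * |ℓ - 2 * m| ≤ -t * (L + 3 + 100 * Real.sqrt x / -t) :=
          mul_le_mul_of_nonneg_left habs hT0.le
        have e1 : -t * (L + 3 + 100 * Real.sqrt x / -t) =
            -t * L + 3 * -t + 100 * Real.sqrt x := by
          have htne : t ≠ 0 := ht.ne
          field_simp
          ring
        rw [e1] at h1
        have h2 : -t * L ≤ T₁ * (2 * x) :=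
          (mul_le_mul_of_nonneg_right (by linarith : -t ≤ T₁) hL0.le).trans
            (mul_le_mul_of_nonneg_left hLx hT10)
        have h3 : T₁ * 1 ≤ T₁ * x := mul_le_mul_of_nonneg_left hx1' hT10
        linarith
      have hR : a + y ≤ 4 * CΩ * x := by
        have : 2 * CΩ * L ≤ 2 * CΩ * (2 * x) := mul_le_mul_of_nonneg_left hLx (by positivity)
        linarith
      have hmain := phase_le_main (T₀ := T₀) (U := 5 * T₁ + 100) (R := 4 * CΩ) hT ht hα hβ hβ0
        hβ1 hx1' hr0.le hL2 hA₁ hA₂ hU hR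
      have hcmp := exponent_le_main (lx := lx) hd ha hℓ0 hℓL hm23 hy hT₁ hT ht hlxL hL1
      linarith [hmain, hcmp, eG]
    · -- regime (iii): `πn² > x e^{100√x/|t|}`
      rw [not_le] at hcase
      have hcond : ζ.im * Real.exp (Real.sqrt ζ.im / |t|) < b := by
        rw [hζim]
        refine lt_of_le_of_lt (mul_le_mul_of_nonneg_left (Real.exp_le_exp.2 ?_) hx0.le) hcase
        rw [htabs]
        exact div_le_div_of_nonneg_right (by linarith) hT0.le
      have hα8 := hiii hcond
      have hlogb2 : 2 * m ≤ logPlus b := by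
        calc 2 * m = Real.log ((n : ℝ) ^ 2) := by rw [Real.log_pow, hmdef]; ring
          _ ≤ Real.log b := Real.log_le_log (by positivity) hbn
          _ ≤ logPlus b := log_le_logPlus b
      have hαm : w₀.re ≤ -(m / 4) := by linarith
      have hαneg : w₀.re < 0 := by linarith
      have hhuge := phase_le_huge hT ht hb0 (by rw [hζre]; exact hr0) hζim hxT hx0 hw₀ hαneg hsad
      rw [hζre, hζim] at hhuge
      -- `50 √x ≤ m (−t)` from `x e^{100√x/|t|} < πn²`
      have h50 : 50 * Real.sqrt x ≤ m * -t := by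
        have h1 : lx + 100 * Real.sqrt x / -t < Real.log b := by
          have := Real.log_lt_log (by positivity) hcase
          rwa [Real.log_mul hx0.ne' (Real.exp_pos _).ne', Real.log_exp, htabs, ← hlxdef] at this
        rw [hlogb] at h1
        have h2 : 100 * Real.sqrt x / -t ≤ 2 * m := by linarith
        rw [div_le_iff₀ hT0] at h2
        linarith
      have hkey : 25 / 16 * Real.sqrt x * m ≤ -t * w₀.re ^ 2 / 2 := by
        have h1 : m ^ 2 / 16 ≤ w₀.re ^ 2 := by
          have h0 : m / 4 ≤ -w₀.re := by linarith
          calc m ^ 2 / 16 = (m / 4) ^ 2 := by ring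
            _ ≤ (-w₀.re) ^ 2 := pow_le_pow_left₀ (by linarith) h0 2
            _ = w₀.re ^ 2 := by ring
        have h2 : -t * (m ^ 2 / 16) ≤ -t * w₀.re ^ 2 := mul_le_mul_of_nonneg_left h1 hT0.le
        have h3 : 50 * Real.sqrt x * m ≤ m * -t * m := mul_le_mul_of_nonneg_right h50 hm0
        linarith
      have hd4 : d ≤ 4 := by rw [hd]; linarith
      have hΘ' : T₀ / 8 + T₀ * π ^ 2 / 64 + (a + y) / 4 + T₀ * L ^ 2 / 16 + 5 / 2 * L ≤
          25 / 48 * Real.sqrt x := by linarith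
      have hcmp := exponent_le_huge (x := x) hd4 hℓ0 hℓL hy0 hT ht hm23 hlxL hkey hsx hΘ'
      linarith [hhuge, hcmp, eG, hB0]
  -- assemble
  have hexp' : Real.exp (d * m) *
      Real.exp ((t : ℂ) * w₀ ^ 2 - b * Complex.exp (4 * w₀) + ζ * w₀).re ≤
      Real.exp (A₁ * (5 * T₁ + 100) / 2 + A₁ * T₀ / 2 + 4 * CΩ * A₁ + A₂) *
        Real.exp ((9 + y) * ℓ / 4 + (t / 16 * ℓ ^ 2 - t * π ^ 2 / 64 - π * x / 8)) *
        Real.exp (-2 * m) * Real.exp (-(5 / 2) * lx) := by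
    rw [← Real.exp_add, ← Real.exp_add, ← Real.exp_add, ← Real.exp_add, Real.exp_le_exp]
    linarith
  calc Real.exp (d * m) * ‖rodgersTaoI t b ζ‖
      ≤ Real.exp (d * m) * ((2 + AI / (1 / 4 : ℝ) ^ (3 / 2 : ℝ)) *
          Real.exp ((t : ℂ) * w₀ ^ 2 - b * Complex.exp (4 * w₀) + ζ * w₀).re) :=
        mul_le_mul_of_nonneg_left hI (Real.exp_pos _).le
    _ = (2 + AI / (1 / 4 : ℝ) ^ (3 / 2 : ℝ)) * (Real.exp (d * m) *
          Real.exp ((t : ℂ) * w₀ ^ 2 - b * Complex.exp (4 * w₀) + ζ * w₀).re) := by ring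
    _ ≤ (2 + AI / (1 / 4 : ℝ) ^ (3 / 2 : ℝ)) *
          (Real.exp (A₁ * (5 * T₁ + 100) / 2 + A₁ * T₀ / 2 + 4 * CΩ * A₁ + A₂) *
            Real.exp ((9 + y) * ℓ / 4 + (t / 16 * ℓ ^ 2 - t * π ^ 2 / 64 - π * x / 8)) *
            Real.exp (-2 * m) * Real.exp (-(5 / 2) * lx)) :=
        mul_le_mul_of_nonneg_left hexp' hA'0
    _ = _ := by ring

/-- **`|Q_{t,n}| ≤ 2π² n⁴ |I_t(πn², 9+y+ix)| + 3π n² |I_t(πn², 5+y+ix)| ≤ (2π² + 3π) R`.**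
[cite: RodgersTaoFMP2020, §2 display after eq. (32) (FMP p. 17)] -/
theorem norm_Q_le {t x y R : ℝ} {n : ℕ} (hn : 1 ≤ n)
    (h9 : Real.exp (4 * Real.log n) * ‖rodgersTaoI t ((π * (n : ℝ) ^ 2 : ℝ) : ℂ) (9 + y + x * I)‖ ≤ R)
    (h5 : Real.exp (2 * Real.log n) * ‖rodgersTaoI t ((π * (n : ℝ) ^ 2 : ℝ) : ℂ) (5 + y + x * I)‖ ≤ R) :
    ‖rodgersTaoQ t n x y‖ ≤ (2 * π ^ 2 + 3 * π) * R := by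
  have hpi := Real.pi_pos
  have hn0 : (0 : ℝ) < n := by exact_mod_cast hn
  have hb : ((π * (n : ℝ) ^ 2 : ℝ) : ℂ) = (π : ℂ) * (n : ℂ) ^ 2 := by push_cast; ring
  rw [hb] at h9 h5
  have e4 : Real.exp (4 * Real.log n) = (n : ℝ) ^ 4 := by
    rw [show (4 : ℝ) * Real.log n = Real.log ((n : ℝ) ^ 4) by rw [Real.log_pow]; norm_num,
      Real.exp_log (by positivity)]
  have e2 : Real.exp (2 * Real.log n) = (n : ℝ) ^ 2 := by
    rw [show (2 : ℝ) * Real.log n = Real.log ((n : ℝ) ^ 2) by rw [Real.log_pow]; norm_num,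
      Real.exp_log (by positivity)]
  rw [e4] at h9
  rw [e2] at h5
  have hnπ : ‖(π : ℂ)‖ = π := by rw [Complex.norm_real, Real.norm_eq_abs, abs_of_pos hpi]
  have h1 : ‖2 * (π : ℂ) ^ 2 * (n : ℂ) ^ 4 * rodgersTaoI t (π * (n : ℂ) ^ 2) (9 + y + x * I)‖ =
      2 * π ^ 2 * ((n : ℝ) ^ 4 * ‖rodgersTaoI t (π * (n : ℂ) ^ 2) (9 + y + x * I)‖) := by
    rw [norm_mul, norm_mul, norm_mul, norm_pow, norm_pow, hnπ, Complex.norm_natCast,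
      Complex.norm_ofNat]; ring
  have h2 : ‖3 * (π : ℂ) * (n : ℂ) ^ 2 * rodgersTaoI t (π * (n : ℂ) ^ 2) (5 + y + x * I)‖ =
      3 * π * ((n : ℝ) ^ 2 * ‖rodgersTaoI t (π * (n : ℂ) ^ 2) (5 + y + x * I)‖) := by
    rw [norm_mul, norm_mul, norm_mul, norm_pow, hnπ, Complex.norm_natCast,
      Complex.norm_ofNat]; ring
  unfold rodgersTaoQ
  calc _ ≤ ‖2 * (π : ℂ) ^ 2 * (n : ℂ) ^ 4 * rodgersTaoI t (π * (n : ℂ) ^ 2) (9 + y + x * I)‖ +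
        ‖3 * (π : ℂ) * (n : ℂ) ^ 2 * rodgersTaoI t (π * (n : ℂ) ^ 2) (5 + y + x * I)‖ :=
        norm_sub_le _ _
    _ = 2 * π ^ 2 * ((n : ℝ) ^ 4 * ‖rodgersTaoI t (π * (n : ℂ) ^ 2) (9 + y + x * I)‖) +
        3 * π * ((n : ℝ) ^ 2 * ‖rodgersTaoI t (π * (n : ℂ) ^ 2) (5 + y + x * I)‖) := by
        rw [h1, h2]
    _ ≤ 2 * π ^ 2 * R + 3 * π * R := by gcongr
    _ = (2 * π ^ 2 + 3 * π) * R := by ring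

/-! ### "For `x` sufficiently large depending on `C`, `T₀`" -/

/-- The threshold `C''` beyond the ones of Lemma 2.3, (31), (36): all the elementary largeness
conditions on `x` used above hold for `x ≥ X(T₀, C_Ω, A₃₆)`. [folklore] -/
private theorem exists_threshold (T₀ CΩ A₃₆ : ℝ) (hT₀ : 0 ≤ T₀) (hCΩ : 0 ≤ CΩ) :
    ∃ X : ℝ, 0 < X ∧ ∀ x : ℝ, X ≤ x →
      4 * π ≤ x ∧ T₀ * π / 2 ≤ x ∧ 1 ≤ logPlus x ∧ logPlus x ≤ 2 * x ∧
      logPlus x ^ 2 ≤ Real.sqrt x ∧ 8 ≤ Real.sqrt x ∧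
      T₀ / 8 + T₀ * π ^ 2 / 64 + CΩ * logPlus x / 2 + T₀ * logPlus x ^ 2 / 16 +
        5 / 2 * logPlus x ≤ 25 / 48 * Real.sqrt x ∧
      A₃₆ ≤ π ^ 2 * Real.sqrt x := by
  have hq2 : (0 : ℝ) < 1 / 2 := by norm_num
  have hq8 : (0 : ℝ) < 1 / 8 := by norm_num
  have hpq : (1 / 4 : ℝ) < 1 / 2 := by norm_num
  have hev := ((eventually_ge_atTop (max (4 * π) (max (T₀ * π / 2) 2))).and
    ((Real.tendsto_log_atTop.eventually_ge_atTop 1).and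
    ((eventually_const_mul_log_le_rpow 1 hq8).and
    ((eventually_const_mul_rpow_le_rpow 4 hpq).and
    ((eventually_const_le_rpow 8 hq2).and
    ((eventually_const_le_rpow A₃₆ hq2).and
    ((eventually_const_le_rpow (8 * (T₀ / 8 + T₀ * π ^ 2 / 64)) hq2).and
    ((eventually_const_mul_log_le_rpow (8 * (CΩ + 5)) hq2).and
    (eventually_const_mul_rpow_le_rpow (2 * T₀) hpq)))))))))
  obtain ⟨X₀, hX₀⟩ := Filter.eventually_atTop.1 hev
  refine ⟨max X₀ 1, by positivity, fun x hx ↦ ?_⟩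
  obtain ⟨h1, h2, h3, h4, h5, h6, h7, h8, h9⟩ := hX₀ x ((le_max_left _ _).trans hx)
  have hpi := Real.pi_gt_three
  have hx4π : 4 * π ≤ x := (le_max_left _ _).trans h1
  have hxT : T₀ * π / 2 ≤ x := ((le_max_left _ _).trans (le_max_right _ _)).trans h1
  have hx2 : 2 ≤ x := ((le_max_right _ _).trans (le_max_right _ _)).trans h1
  have hx0 : 0 < x := by linarith
  have hs : Real.sqrt x = x ^ (1 / 2 : ℝ) := Real.sqrt_eq_rpow x
  rw [hs]
  set s := x ^ (1 / 2 : ℝ) with hsdef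
  set lx := Real.log x with hlx
  have hs0 : 0 ≤ s := Real.rpow_nonneg hx0.le _
  have hlx0 : 0 ≤ lx := by linarith
  -- `log₊ x = log (2 + x) ≤ 2 log x`
  have hL : logPlus x = Real.log (2 + x) := by rw [logPlus_eq, abs_of_pos hx0]
  have hLlx : logPlus x ≤ 2 * lx := by
    rw [hL]
    have hlog2 : Real.log 2 ≤ lx := Real.log_le_log (by norm_num) hx2
    calc Real.log (2 + x) ≤ Real.log (2 * x) := Real.log_le_log (by linarith) (by linarith)
      _ = Real.log 2 + lx := by rw [Real.log_mul (by norm_num) hx0.ne']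
      _ ≤ 2 * lx := by linarith
  have hL1 : 1 ≤ logPlus x := h2.trans (log_le_logPlus x)
  have hL0 : 0 ≤ logPlus x := by linarith
  have hlxx : lx ≤ x := by have := Real.log_le_sub_one_of_pos hx0; linarith
  -- `lx² ≤ x^{1/4}`
  have hlx8 : lx ≤ x ^ (1 / 8 : ℝ) := by simpa using h3
  have hlx2 : lx ^ 2 ≤ x ^ (1 / 4 : ℝ) := by
    calc lx ^ 2 ≤ (x ^ (1 / 8 : ℝ)) ^ 2 := pow_le_pow_left₀ hlx0 hlx8 2
      _ = x ^ (1 / 4 : ℝ) := by rw [← Real.rpow_mul_natCast hx0.le]; norm_num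
  have hL2 : logPlus x ^ 2 ≤ 4 * lx ^ 2 := by nlinarith
  refine ⟨hx4π, hxT, hL1, by linarith, ?_, h5, ?_, ?_⟩
  · linarith
  · have hΘ1 : CΩ * logPlus x / 2 ≤ CΩ * lx := by nlinarith
    have hΘ2 : T₀ * logPlus x ^ 2 / 16 ≤ T₀ / 4 * x ^ (1 / 4 : ℝ) := by nlinarith
    nlinarith
  · have hπ2 : (1 : ℝ) ≤ π ^ 2 := by nlinarith
    have : 1 * s ≤ π ^ 2 * s := mul_le_mul_of_nonneg_right hπ2 hs0
    linarith

end RodgersTaoTailSum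

open RodgersTaoTailSum in
/-- **Rodgers–Tao 2020, §2, the display of FMP p. 19** — `H_t(x − iy) = (½ + O_C(log²₊x/x)) Q_{t,1}`
uniformly for `−T₀ ≤ t < 0`, `x ≥ C''`, `y = κ log₊ x`, `C' ≤ κ ≤ C` — **from** Lemma 2.3
(`rodgersTao_saddlePoint`), (31) (`rodgersTao_I_asymp`), (22) (`rodgersTao_I_shift`, unused),
(18) = (32) (`rodgersTao_H_hasSum_Q`) and (36) (`rodgersTao_Q_one_asymp`). Signature of record
(rt-lead ruling (30)(b)). Proof route and the `T₀`-uniformity divergence: module docstring.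
[cite: RodgersTaoFMP2020, §2 proof of Lemma 2.1, FMP pp. 17–19 = arXiv:1801.05914v5 ll. 430–497] -/
theorem rodgersTao_H_eq_half_Q_one_of (hS : rodgersTao_saddlePoint) (hI : rodgersTao_I_asymp)
    (_hSh : rodgersTao_I_shift) (hQ : rodgersTao_H_hasSum_Q) (h36 : rodgersTao_Q_one_asymp) :
    rodgersTao_H_eq_half_Q_one := by
  intro T₀
  have hpi := Real.pi_gt_three
  have hpi4 := Real.pi_le_four
  obtain ⟨T₁, hT₁def⟩ : ∃ T₁ : ℝ, T₁ = max T₀ 1 := ⟨_, rfl⟩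
  have hT₁0 : 1 ≤ T₁ := by rw [hT₁def]; exact le_max_right _ _
  have hT₀₁ : T₀ ≤ T₁ := by rw [hT₁def]; exact le_max_left _ _
  obtain ⟨C'S, A₁, hC'S, hA₁, hS1⟩ := hS T₁
  obtain ⟨C'I, hC'I, hI1⟩ := hI T₁
  obtain ⟨C'₃₆, hC'₃₆, h361⟩ := h36 T₀
  obtain ⟨C', hC'def⟩ : ∃ C' : ℝ, C' = max (max C'S C'I) (max C'₃₆ (T₁ / 2 + 16)) := ⟨_, rfl⟩
  have hC'S' : C'S ≤ C' := by rw [hC'def]; exact le_trans (le_max_left _ _) (le_max_left _ _)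
  have hC'I' : C'I ≤ C' := by rw [hC'def]; exact le_trans (le_max_right _ _) (le_max_left _ _)
  have hC'36 : C'₃₆ ≤ C' := by rw [hC'def]; exact le_trans (le_max_left _ _) (le_max_right _ _)
  have hC'T : T₁ / 2 + 16 ≤ C' := by
    rw [hC'def]; exact le_trans (le_max_right _ _) (le_max_right _ _)
  refine ⟨C', lt_of_lt_of_le hC'₃₆ hC'36, fun C ↦ ?_⟩
  obtain ⟨CΩ, hCΩdef⟩ : ∃ CΩ : ℝ, CΩ = max C 0 + 9 := ⟨_, rfl⟩
  have hCΩ0 : 0 ≤ CΩ := by rw [hCΩdef]; positivity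
  have hCΩC : max C 0 ≤ CΩ := by rw [hCΩdef]; linarith
  have hCΩ9 : 9 ≤ CΩ := by rw [hCΩdef]; linarith [le_max_right C 0]
  obtain ⟨C''S, A₂, hC''S, hA₂, hS2⟩ := hS1 C' hC'S' CΩ
  have hS3 := hS2 C''S le_rfl
  obtain ⟨C''I, AI, hC''I, hAI, hI2⟩ := hI1 C' hC'I' CΩ
  have hI3 := hI2 C''I le_rfl
  obtain ⟨C''₃₆, A₃₆, hC''₃₆, hA₃₆, h362⟩ := h361 C
  obtain ⟨X, hX0, hX⟩ := exists_threshold T₁ CΩ A₃₆ (by linarith) hCΩ0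
  obtain ⟨C'', hC''def⟩ : ∃ C'' : ℝ, C'' = max (max C''S C''I) (max C''₃₆ X) := ⟨_, rfl⟩
  have hC''S' : C''S ≤ C'' := by rw [hC''def]; exact le_trans (le_max_left _ _) (le_max_left _ _)
  have hC''I' : C''I ≤ C'' := by rw [hC''def]; exact le_trans (le_max_right _ _) (le_max_left _ _)
  have hC''36 : C''₃₆ ≤ C'' := by
    rw [hC''def]; exact le_trans (le_max_left _ _) (le_max_right _ _)
  have hC''X : X ≤ C'' := by rw [hC''def]; exact le_trans (le_max_right _ _) (le_max_right _ _)
  -- the constant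
  obtain ⟨M₀, hM₀def⟩ : ∃ M₀ : ℝ, M₀ = (2 * π ^ 2 + 3 * π) * ((2 + AI / (1 / 4 : ℝ) ^ (3 / 2 : ℝ)) *
      Real.exp (A₁ * (5 * T₁ + 100) / 2 + A₁ * T₁ / 2 + 4 * CΩ * A₁ + A₂)) := ⟨_, rfl⟩
  have hM₀0 : 0 < M₀ := by rw [hM₀def]; positivity
  refine ⟨C'', M₀, lt_of_lt_of_le hX0 hC''X, hM₀0, ?_⟩
  intro t ht x hx κ hκ
  have htlt : t < 0 := ht.2
  have hT : -T₁ ≤ t := le_trans (by linarith) ht.1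
  have htI : t ∈ Ico (-T₁) 0 := ⟨hT, htlt⟩
  obtain ⟨hx4π, hxT, hL1, hLx, hL2, hsx, hΘ, hA36⟩ := hX x (hC''X.trans hx)
  have hx0 : 0 < x := by linarith
  have hx1 : 1 ≤ x := by linarith
  have hL0 : 0 < logPlus x := logPlus_pos x
  obtain ⟨y, hydef⟩ : ∃ y : ℝ, y = κ * logPlus x := ⟨_, rfl⟩
  have hκC' : C' ≤ κ := hκ.1
  have hκ0 : 0 ≤ κ := by linarith
  have hy : (T₁ / 2 + 16) * logPlus x ≤ y := by
    rw [hydef]; exact mul_le_mul_of_nonneg_right (hC'T.trans hκC') hL0.le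
  have hy0 : 0 ≤ y := by rw [hydef]; positivity
  have hyC' : C' * logPlus x ≤ y := by rw [hydef]; exact mul_le_mul_of_nonneg_right hκC' hL0.le
  have hr9 : 9 + y ≤ 2 * CΩ * logPlus x := by
    have h1 : κ * logPlus x ≤ max C 0 * logPlus x :=
      mul_le_mul_of_nonneg_right (hκ.2.trans (le_max_left _ _)) hL0.le
    have h2 : max C 0 * logPlus x ≤ CΩ * logPlus x := mul_le_mul_of_nonneg_right hCΩC hL0.le
    have h3 : 9 * 1 ≤ CΩ * logPlus x := mul_le_mul hCΩ9 hL1 zero_le_one hCΩ0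
    rw [hydef]; linarith
  have hr5 : 5 + y ≤ 2 * CΩ * logPlus x := by linarith
  -- `ζ_a ∈ Ω`
  have hmem : ∀ a : ℝ, 0 ≤ a → a + y ≤ 2 * CΩ * logPlus x → ∀ C''₀ : ℝ, C''₀ ≤ C'' →
      ((a : ℂ) + y + x * I) ∈ rodgersTaoOmega CΩ C' C''₀ := by
    intro a ha har C''₀ hC''₀
    rw [mem_rodgersTaoOmega]
    have hre : ((a : ℂ) + y + x * I).re = a + y := by simp
    have him : ((a : ℂ) + y + x * I).im = x := by simp
    rw [hre, him]
    exact ⟨hC''₀.trans hx, by linarith, har⟩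
  -- the bound for `Q_{t,n}`, `n ≥ 2`
  have hterm : ∀ n : ℕ, 2 ≤ n → ‖rodgersTaoQ t n x y‖ ≤
      M₀ * Real.exp ((9 + y) * Real.log (x / (4 * π)) / 4 +
        (t / 16 * Real.log (x / (4 * π)) ^ 2 - t * π ^ 2 / 64 - π * x / 8)) *
        Real.exp (-(5 / 2) * Real.log x) * (n : ℝ) ^ (-2 : ℝ) := by
    intro n hn
    have hn0 : (0 : ℝ) < n := by exact_mod_cast (show 0 < n by omega)
    have hb1 : (1 : ℝ) ≤ π * (n : ℝ) ^ 2 := by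
      have h1n : (1 : ℝ) ≤ n := by exact_mod_cast (show 1 ≤ n by omega)
      have h1 : (1 : ℝ) ≤ (n : ℝ) ^ 2 := one_le_pow₀ h1n
      calc (1 : ℝ) = 1 * 1 := by norm_num
        _ ≤ π * (n : ℝ) ^ 2 := mul_le_mul (by linarith) h1 zero_le_one (by linarith)
    have e9 : (9 : ℂ) + y + x * I = ((9 : ℝ) : ℂ) + y + x * I := by push_cast; ring
    have e5 : (5 : ℂ) + y + x * I = ((5 : ℝ) : ℂ) + y + x * I := by push_cast; ring
    have hζ9S : ((9 : ℂ) + y + x * I) ∈ rodgersTaoOmega CΩ C' C''S := by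
      rw [e9]; exact hmem 9 (by norm_num) hr9 C''S hC''S'
    have hζ9I : ((9 : ℂ) + y + x * I) ∈ rodgersTaoOmega CΩ C' C''I := by
      rw [e9]; exact hmem 9 (by norm_num) hr9 C''I hC''I'
    have hζ5S : ((5 : ℂ) + y + x * I) ∈ rodgersTaoOmega CΩ C' C''S := by
      rw [e5]; exact hmem 5 (by norm_num) hr5 C''S hC''S'
    have hζ5I : ((5 : ℂ) + y + x * I) ∈ rodgersTaoOmega CΩ C' C''I := by
      rw [e5]; exact hmem 5 (by norm_num) hr5 C''I hC''I'
    have h9 := exp_mul_norm_I_le (T₀ := T₁) (T₁ := T₁) (a := 9) (d := 4) hn hT htlt le_rfl rfl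
      e9 rfl rfl rfl rfl hx4π hxT hL1 hLx hL2 hsx hy hr9 hCΩ0 (by norm_num) (by norm_num)
      (by norm_num) hA₁.le hA₂.le hAI.le hΘ (hS3 t htI _ hb1 _ hζ9S) (hI3 t htI _ hb1 _ hζ9I)
    have h5 := exp_mul_norm_I_le (T₀ := T₁) (T₁ := T₁) (a := 5) (d := 2) hn hT htlt le_rfl rfl
      e5 rfl rfl rfl rfl hx4π hxT hL1 hLx hL2 hsx hy hr5 hCΩ0 (by norm_num) (by norm_num)
      (by norm_num) hA₁.le hA₂.le hAI.le hΘ (hS3 t htI _ hb1 _ hζ5S) (hI3 t htI _ hb1 _ hζ5I)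
    have hQn := norm_Q_le (by omega) h9 h5
    have en : Real.exp (-2 * Real.log n) = (n : ℝ) ^ (-2 : ℝ) := by
      rw [Real.rpow_def_of_pos hn0]; ring_nf
    rw [hM₀def, ← en]
    calc _ ≤ _ := hQn
      _ = _ := by ring
  -- the tail sum `∑_{n ≥ 2} Q_{t,n}`
  obtain ⟨K, hKdef⟩ : ∃ K : ℝ, K = M₀ * Real.exp ((9 + y) * Real.log (x / (4 * π)) / 4 +
      (t / 16 * Real.log (x / (4 * π)) ^ 2 - t * π ^ 2 / 64 - π * x / 8)) *
      Real.exp (-(5 / 2) * Real.log x) := ⟨_, rfl⟩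
  have hK0 : 0 ≤ K := by rw [hKdef]; positivity
  have hterm' : ∀ n : ℕ, ‖rodgersTaoQ t (n + 1 + 1) x y‖ ≤ K * ((n + 2 : ℕ) : ℝ) ^ (-2 : ℝ) := by
    intro n
    rw [hKdef]
    exact hterm (n + 2) (by omega)
  have hg : Summable fun n : ℕ ↦ K * ((n + 2 : ℕ) : ℝ) ^ (-2 : ℝ) :=
    ((summable_nat_add_iff 2).2 summable_nat_rpow_neg_two).mul_left K
  have htail2 : ∑' n : ℕ, ((n + 2 : ℕ) : ℝ) ^ (-2 : ℝ) ≤ 2 := by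
    have h := summable_nat_rpow_neg_two.sum_add_tsum_nat_add 2
    have h0 : 0 ≤ ∑ i ∈ Finset.range 2, (i : ℝ) ^ (-2 : ℝ) :=
      Finset.sum_nonneg fun i _ ↦ Real.rpow_nonneg i.cast_nonneg _
    linarith [tsum_nat_rpow_neg_two_le]
  have hH := hQ t htlt x y
  have hsplit : 2 * deBruijnH t ((x : ℂ) - I * y) - rodgersTaoQ t 1 x y =
      ∑' n : ℕ, rodgersTaoQ t (n + 1 + 1) x y := by
    rw [← hH.tsum_eq, hH.summable.tsum_eq_zero_add]
    ring
  have htail : ‖2 * deBruijnH t ((x : ℂ) - I * y) - rodgersTaoQ t 1 x y‖ ≤ 2 * K := by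
    rw [hsplit]
    refine (tsum_of_norm_bounded hg.hasSum hterm').trans ?_
    rw [tsum_mul_left]
    calc K * ∑' n : ℕ, ((n + 2 : ℕ) : ℝ) ^ (-2 : ℝ) ≤ K * 2 :=
          mul_le_mul_of_nonneg_left htail2 hK0
      _ = 2 * K := by ring
  -- the main term from (36): `|Q_{t,1}| ≥ π² (x/4π)^{(9+y)/4} J_t(x) ≥ (π²/√x) e^{G₉}`
  have h36x := h362 t ht x (hC''36.trans hx) κ ⟨hC'36.trans hκC', hκ.2⟩
  rw [← hydef] at h36x
  have hJ : (x / (4 * π)) ^ ((9 + y) / 4) * rodgersTaoJ t x =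
      Real.sqrt (π / (2 * x)) * Real.exp ((9 + y) * Real.log (x / (4 * π)) / 4 +
        (t / 16 * Real.log (x / (4 * π)) ^ 2 - t * π ^ 2 / 64 - π * x / 8)) := by
    rw [rodgersTaoJ, Real.rpow_def_of_pos (by positivity), Real.exp_add]
    ring_nf
  have hTpos : 0 < (x / (4 * π)) ^ ((9 + y) / 4) * rodgersTaoJ t x := by
    rw [hJ]; exact mul_pos (Real.sqrt_pos.2 (by positivity)) (Real.exp_pos _)
  have hQ1 : π ^ 2 * ((x / (4 * π)) ^ ((9 + y) / 4) * rodgersTaoJ t x) ≤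
      ‖rodgersTaoQ t 1 x y‖ := by
    have h1 := (abs_le.1 h36x).1
    have hsx0 : 0 < Real.sqrt x := Real.sqrt_pos.2 hx0
    have h2 : A₃₆ / Real.sqrt x ≤ π ^ 2 := by rw [div_le_iff₀ hsx0]; linarith
    have h3 : π ^ 2 ≤ ‖rodgersTaoQ t 1 x y‖ / ((x / (4 * π)) ^ ((9 + y) / 4) * rodgersTaoJ t x) := by
      linarith
    rwa [le_div_iff₀ hTpos] at h3
  have hsqrt : (Real.sqrt x)⁻¹ ≤ Real.sqrt (π / (2 * x)) := by
    rw [← Real.sqrt_inv]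
    refine Real.sqrt_le_sqrt ?_
    rw [show π / (2 * x) = (π / 2) * x⁻¹ by ring]
    exact le_mul_of_one_le_left (inv_nonneg.2 hx0.le) (by linarith)
  -- `e^{G₉} ≤ |Q₁| √x / π²`
  have hG : Real.exp ((9 + y) * Real.log (x / (4 * π)) / 4 +
      (t / 16 * Real.log (x / (4 * π)) ^ 2 - t * π ^ 2 / 64 - π * x / 8)) ≤
      ‖rodgersTaoQ t 1 x y‖ * Real.sqrt x / π ^ 2 := by
    rw [hJ] at hQ1
    have hsx0 : 0 < Real.sqrt x := Real.sqrt_pos.2 hx0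
    have hπ2 : (0 : ℝ) < π ^ 2 := by positivity
    rw [le_div_iff₀ hπ2]
    have h1 : π ^ 2 * ((Real.sqrt x)⁻¹ * Real.exp ((9 + y) * Real.log (x / (4 * π)) / 4 +
        (t / 16 * Real.log (x / (4 * π)) ^ 2 - t * π ^ 2 / 64 - π * x / 8))) ≤
        ‖rodgersTaoQ t 1 x y‖ :=
      le_trans (mul_le_mul_of_nonneg_left (mul_le_mul_of_nonneg_right hsqrt (Real.exp_pos _).le)
        hπ2.le) hQ1
    have h2 := mul_le_mul_of_nonneg_right h1 hsx0.le
    have e : π ^ 2 * ((Real.sqrt x)⁻¹ * Real.exp ((9 + y) * Real.log (x / (4 * π)) / 4 +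
        (t / 16 * Real.log (x / (4 * π)) ^ 2 - t * π ^ 2 / 64 - π * x / 8))) * Real.sqrt x =
        Real.exp ((9 + y) * Real.log (x / (4 * π)) / 4 +
        (t / 16 * Real.log (x / (4 * π)) ^ 2 - t * π ^ 2 / 64 - π * x / 8)) * π ^ 2 := by
      field_simp
    linarith
  -- `√x · x^{-5/2} = x^{-2} ≤ 1/x ≤ log²₊x / x`
  have hpow : Real.sqrt x * Real.exp (-(5 / 2) * Real.log x) ≤ logPlus x ^ 2 / x := by
    have e1 : Real.sqrt x * Real.exp (-(5 / 2) * Real.log x) = Real.exp (-2 * Real.log x) := by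
      rw [Real.sqrt_eq_rpow, Real.rpow_def_of_pos hx0, ← Real.exp_add]; ring_nf
    have e2 : Real.exp (-Real.log x) = 1 / x := by
      rw [Real.exp_neg, Real.exp_log hx0, one_div]
    have hlog0 : 0 ≤ Real.log x := Real.log_nonneg hx1
    rw [e1]
    calc Real.exp (-2 * Real.log x) ≤ Real.exp (-Real.log x) := Real.exp_le_exp.2 (by linarith)
      _ = 1 / x := e2
      _ ≤ logPlus x ^ 2 / x := div_le_div_of_nonneg_right (one_le_pow₀ hL1) hx0.le
  -- conclusion
  have hZ : rodgersTaoZ x κ = (x : ℂ) - I * y := by rw [hydef]; rfl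
  rw [hZ, ← hydef]
  have e : deBruijnH t ((x : ℂ) - I * y) - rodgersTaoQ t 1 x y / 2 =
      (2 * deBruijnH t ((x : ℂ) - I * y) - rodgersTaoQ t 1 x y) / 2 := by ring
  rw [e, norm_div, Complex.norm_ofNat, div_le_iff₀ (by norm_num : (0 : ℝ) < 2)]
  refine htail.trans ?_
  rw [hKdef]
  have hQ0 : 0 ≤ ‖rodgersTaoQ t 1 x y‖ := norm_nonneg _
  calc 2 * (M₀ * Real.exp ((9 + y) * Real.log (x / (4 * π)) / 4 +
        (t / 16 * Real.log (x / (4 * π)) ^ 2 - t * π ^ 2 / 64 - π * x / 8)) *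
        Real.exp (-(5 / 2) * Real.log x))
      ≤ 2 * (M₀ * (‖rodgersTaoQ t 1 x y‖ * Real.sqrt x / π ^ 2) *
        Real.exp (-(5 / 2) * Real.log x)) := by gcongr
    _ = 2 / π ^ 2 * M₀ * ‖rodgersTaoQ t 1 x y‖ *
        (Real.sqrt x * Real.exp (-(5 / 2) * Real.log x)) := by ring
    _ ≤ 1 * M₀ * ‖rodgersTaoQ t 1 x y‖ * (logPlus x ^ 2 / x) := by
        have h2π : 2 / π ^ 2 ≤ (1 : ℝ) := by
          rw [div_le_one (by positivity)]
          have h9 : (3 : ℝ) ^ 2 ≤ π ^ 2 := pow_le_pow_left₀ (by norm_num) hpi.le 2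
          linarith
        gcongr
    _ = M₀ * (logPlus x ^ 2 / x) * ‖rodgersTaoQ t 1 x y‖ * 1 := by ring
    _ ≤ M₀ * (logPlus x ^ 2 / x) * ‖rodgersTaoQ t 1 x y‖ * 2 := by gcongr; norm_num

/-! ### § LEAF — the hypothesis-free discharges (rt-lead ruling (51)(a)) -/

/-- **Rodgers–Tao 2020, the display of FMP p. 19, hypothesis-free**: `rodgersTao_H_eq_half_Q_one`
from the kernel theorems for Lemma 2.3, (31), (22), (18) = (32) and (36) of
`RodgersTaoAsymptoticsProofs.lean`. [cite: RodgersTaoFMP2020, §2 proof of Lemma 2.1, FMP pp. 17–19] -/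
theorem rodgersTao_H_eq_half_Q_one_holds : rodgersTao_H_eq_half_Q_one :=
  rodgersTao_H_eq_half_Q_one_of rodgersTao_saddlePoint_holds rodgersTao_I_asymp_holds
    rodgersTao_I_shift_holds rodgersTao_H_hasSum_Q_holds rodgersTao_Q_one_asymp_holds

/-- **Rodgers–Tao 2020, Lemma 2.1 (ii) = FMP Lemma 4, eq. (8)**, hypothesis-free, via
`rodgersTao_H_asymp_of` (`RodgersTaoMainAsymptoticsProofs.lean`) from the p. 19 display and (36).
[cite: RodgersTaoFMP2020, Lemma 2.1 eq. (8) (FMP Lemma 4 p. 8; proof pp. 11–19)] -/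
theorem rodgersTao_H_asymp_holds : rodgersTao_H_asymp :=
  rodgersTao_H_asymp_of rodgersTao_H_eq_half_Q_one_holds rodgersTao_Q_one_asymp_holds

/-- **Rodgers–Tao 2020, Lemma 2.1 (iii) = FMP Lemma 4, eq. (9)**, hypothesis-free, via
`rodgersTao_logDeriv_H_asymp_of_H_eq_half_Q_one` (`RodgersTaoLogDerivAsymptoticsProofs.lean`) from
the p. 19 display. [cite: RodgersTaoFMP2020, Lemma 2.1 (iii) eq. (9) (FMP Lemma 4 p. 9, p. 19)] -/
theorem rodgersTao_logDeriv_H_asymp_holds : rodgersTao_logDeriv_H_asymp :=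
  rodgersTao_logDeriv_H_asymp_of_H_eq_half_Q_one rodgersTao_H_eq_half_Q_one_holds

end Literature.NumberTheory.LFunctions

end
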